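import Summits.Langlands.Langlands.Theses.NonParallelVoid
import Literature.NumberTheory.PAdicHodge.FontaineDpst
import Literature.NumberTheory.PAdicHodge.BdRDataNonempty
import Literature.NumberTheory.GaloisRepresentations.LocalGaloisGroupProofs
import HarnessLib

/-!
# Disproof of `EmptyWeightCore` (stmt-Langlands-17008) — findings: NO KILL (cycle 1)

Standing disprover `refuter-cdisprove-stmt-Langlands-17008-0`, route `NonParallelVoid`, crux rank 2,
picked line `Lines/local_clause_cut.lean` (lead `prover-line-stmt-Langlands-17008-0`, 7 stubs).
Everything below is `lean check`ed (rc 0); prose lives in docstrings.  INDEX: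

* §1 `emptyWeightCore_iff_regimeEmpty` — the crux SAYS its regime is empty: under `hHT` (two distinct
  weights per label) and `¬hE` (an odd gap sum exists) the conclusion `∃ g, HT = {a, a+g}` is false, so
  `EmptyWeightCore ↔ (hypotheses → False)`.  A refutation = ONE `ρ` in the regime with every hypothesis
  PROVED.
* §2 LOAD-BEARING ANALYSIS.  For Fontaine's datum the regime is empty by DETERMINANT PARITY (the line):
  `det ρ|_{I_v} = ε^{-(a_v+b_v)}` (crystalline, clause (F12)), base-change type transports `I_w → I_v` up
  to `χ̄²`, `ω̄ ∘ θ_τ = ω̄`, and `χ̄² = ω̄ⁿ on I_{F_w} ⇒ n even` for `F_w = ℚ_p`, `p` odd — also for the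
  ABSTRACT `χ` of the typed hypothesis (χ²|P = 1 and the pro-p wild inertia is 2-divisible ⇒ χ|P = 1;
  Frobenius ⇒ χ^{p-1} = 1 on I; `χ(σ₀) ∈ μ_{p-1}(k) = ⟨ι ω̄(σ₀)⟩`).  Hypotheses USED: crystalline at both
  places, det clause of base-change type, `p` odd, split (`f = 1`).  DECORATIVE for the mechanism:
  irreducibility, a.e. unramified, `¬` nearly ordinary, `11 ≤ p` beyond oddness, residual absolute
  irreducibility over `F(ζ_p)`, the trace clause.  No `_false_without_<H>` theorem EXISTS for this crux:
  every weakening enlarges the regime into an OPEN case of Fontaine–Mazur / Calegari–Mazur believed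
  EMPTY (`EmptyWeightCoreDeRham` below; [CalegariMazur2008] p. 3: "the cuspidal cohomology of GL(2)/K
  vanishes for non-parallel weights" (Harder), §7: non-parallel nearly ordinary FAMILIES exist, no
  algebraic non-parallel point is known; Childers arXiv:2001.04956 §1).  What IS certified is where the
  MECHANISM dies, as arithmetic of the parity channel: `parity_channel_iff` (odd `p`: the determinant
  channel carries exactly ONE bit — so the strategist's S⁺ "gaps ≡ ± mod (p−1)" is NOT in the det
  channel, it needs Fontaine–Laffaille (F13)), `parity_channel_two` (`p = 2`: no bit),
  `parity_channel_inert` (inert `p`, `f = 2`: the transported exponent `(p−1)(h_τ − h_τ̄)` is always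
  even, `ω̄|I = θ₂^{p+1}` is a square — no obstruction; that sector is `ResidueParallel`'s, not ours).
* §3 UNREFUTABILITY AS TYPED — `Twin.*` = verbatim the ACCEPTED negative lemma p167274 (commit 652cace4),
  `Theorems/EmptyWeightCore/Negative/PinTwinNoRamifiedCrystalline.lean` (v2 of this file imports it):
  the pin `fontainePst` is Hilbert's `ε` over the data on `B_dR` with the canonical `ℚ_p`-structure, and
  a TWIN with the same two unconditional invariants (`algebra`, `HEq 𝔅`) declares NO ramified rank-≥2
  representation crystalline (ramified `ρ ↦` Steinberg-type `(diag(q^{deg},1,…), E₀₁)`, `N ≠ 0`).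
  Regular Hodge–Tate weights force `ρ.toLocal v` ramified, so hypothesis H5 of the crux is unprovable
  for every candidate `ρ` by any argument uniform over the `ε`-range: `¬EmptyWeightCore` is out of reach
  in Lean (not merely in mathematics), and so is an unconditional S1 (the accepted naive witness of
  `nonempty_pstWeilDeligneData_bdR` declares every de Rham `ρ` crystalline).  The crux closes exactly
  modulo `FontaineDatumExists` — the lead's stated status.
* §4 STUB PRE-TRIAGE of `local_clause_cut` (no `targets` served yet; read as typed, all TRUE):
  S1 `stub_pinnedCrystallineDetLocal` — (F12) specialised; conditional on `FontaineDatumExists`, see §3.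
  B `stub_splitPrime` — two places above `p` in a quadratic field ⇒ `e = f = 1` everywhere above `p`
  (includes `p = 2`, harmless).  C `stub_residualDet` — det of the tree's `residualRep` (rank 2, no junk)
  is the reduction of det: constant coefficient of `hasResidualCharpolys`.  D `stub_inertiaTransport` —
  `θ_τ(res_w I_{F_w}) ⊆ g · res_v(I_{F_v}) · g⁻¹`: needs `res_v(I_{F_v}) = I_{𝔓_v}` (EQUALITY, the tree's
  `inertia_adicCompletionPrime_eq_map_absInertia`), not just `⊆` — check that lemma's hypotheses early.
  E `stub_cyclotomicOuterConj` — `ε_ℚ ∘ res`, abelian target.  N `stub_cyclotomicResidue` — units reduce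
  multiplicatively.  F `stub_localSquareParity` — TRUE for abstract `χ` and ANY field `k ⊇ ι(𝔽_p)` (proof
  in §2); its hypotheses `p ≠ 2` and `residueFieldCard K = p` are both load-bearing (`parity_channel_two`,
  `parity_channel_inert`: for `K = ℚ_{p²}`, `χ = θ₂^{(p+1)/2}`, `n = 1` is a counterexample to the
  `f = 2` analogue), `Irreducible (p : 𝒪[K])` (e = 1) is what makes `ω̄(I_K) = 𝔽_pˣ` have exact order
  `p − 1` via `exists_isPrimitiveRoot_kummerCharacter`.  TECHNIQUE NUDGE for F's one genuinely new
  step "χ²|_P = 1 ⇒ χ|_P = 1 for ABSTRACT χ": it is FALSE for a general group with an index-2 subgroup,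
  and `P` (free pro-p of infinite rank) has non-open finite-index subgroups, so do NOT look for
  "finite-index ⇒ open"; what is true and enough is ELEMENTWISE 2-divisibility of `P` for `p` odd:
  for `σ ∈ P` put `η_a := σ^{(p^a+1)/2} ∈ P`; by `absWildInertia_isProP_holds` `σ^{p^a} → 1`
  (once `σ^{p^a} ∈ N` then `σ^{p^{a+b}} ∈ N`), so `η_a² = σ^{p^a}·σ → σ`; a cluster point `η` of
  `(η_a)` in the compact `Γ_K` lies in `P` (closed: an intersection of stabilisers for the Krull
  topology, cf. `isClosed_absInertia_holds`) and satisfies `η² = σ` (squaring is continuous, limits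
  are unique); then `χ(σ) = χ(η)² ∈ {(±1)²} = {1}`.
* §5 WHAT WOULD KILL, and why it is out of reach: (a) an irreducible de Rham `ρ : Γ_F → GL₂(ℚ̄_p)` with
  non-parallel regular weights over an imaginary quadratic `F` — a counterexample to Fontaine–Mazur +
  purity (motivic rank 2 ⇒ `HT_τ̄ = w − HT_τ` ⇒ parallel; induced-from-CM-quartic ⇒ parallel; reducible ⇒
  excluded by H1) — none known, no finite search space; (b) an inconsistency among the clauses (F1)–(F13)
  of `IsFontaineDatum` would make `FontaineDatumExists` false and every conditional proof vacuous, but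
  would NOT refute the crux (H5 stays uncertifiable); the period-ring clauses (F2), (F3), (F11) are
  already theorems for the constructed `B_dR` (`FontaineDpstUnconditional`, `CyclotomicPowersLabelledWeightsBdR`),
  and (F12) agrees with (F11) on `ε^m` (`det_eq_neg_sum_of_entry`) — no cheap inconsistency found.

References: [CalegariMazur2008] arXiv:0708.2451 Conj. 1.3, Cor. 1.4, Thm 1.5, §7.1; [Calegari2010]
arXiv:0907.3427 Thm 1.4; Childers arXiv:2001.04956 §1; [TateCorvallis1979] (4.1.4);
[FontaineAsterisque223VIII] §2.3.7; Serre, Inventiones 15 (1972) §1 (tame characters).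
-/

set_option linter.dupNamespace false
set_option linter.unusedVariables false

noncomputable section

open Field ValuativeRel
open scoped MatrixGroups

namespace Summit.Langlands.Langlands.Cruxes.EmptyWeightCore.Disproof

open Summit.Langlands.Langlands.Theses.NonParallelVoid
open Literature.NumberTheory.GaloisRepresentations Literature.NumberTheory.PAdicHodge
open Literature.NumberTheory.GaloisRepresentations.IsNonarchimedeanLocalField
open IsDedekindDomain NumberField

/-! ## §1 The crux says: the regime is empty -/

/-- The gap of an increasing pair equal to an unordered pair `{c, c + g}` is `± g`. [folklore] -/
theorem gap_eq_or_of_pair_eq {a b c g : ℤ} (h : ({a, b} : Multiset ℤ) = {c, c + g}) (hlt : a < b) :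
    b - a = g ∨ b - a = -g := by
  have ha : a ∈ ({c, c + g} : Multiset ℤ) := h ▸ Multiset.mem_cons_self a _
  have hb : b ∈ ({c, c + g} : Multiset ℤ) :=
    h ▸ (Multiset.mem_cons.2 (Or.inr (Multiset.mem_singleton_self b)))
  have hc : c ∈ ({a, b} : Multiset ℤ) := h.symm ▸ Multiset.mem_cons_self c _
  have hcg : c + g ∈ ({a, b} : Multiset ℤ) :=
    h.symm ▸ (Multiset.mem_cons.2 (Or.inr (Multiset.mem_singleton_self (c + g))))
  simp only [Multiset.insert_eq_cons, Multiset.mem_cons, Multiset.mem_singleton] at ha hb hc hcg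
  omega

/-- **The regime of the crux**: all binders and hypotheses of `EmptyWeightCore`, conclusion `False`.
A refutation of the crux is exactly an inhabitant of the negation of this: ONE `(F, p, ρ)` with every
hypothesis proved. [folklore] -/
def RegimeEmpty : Prop :=
  ∀ (F : Type) [Field F] [NumberField F] [Algebra.IsQuadraticExtension ℚ F], NumberField.IsTotallyComplex F → ∀ (p : ℕ) [Fact p.Prime] (ρ : Literature.NumberTheory.GaloisRepresentations.FramedGaloisRep F (PadicAlgCl p) 2), ρ.toGaloisRep.IsIrreducible → (∀ᶠ v : IsDedekindDomain.HeightOneSpectrum (NumberField.RingOfIntegers F) in Filter.cofinite, ρ.IsUnramifiedAt v) → (∀ (v : IsDedekindDomain.HeightOneSpectrum (NumberField.RingOfIntegers F)) (hv : ((p : ℕ) : NumberField.RingOfIntegers F) ∈ v.asIdeal), (Literature.NumberTheory.PAdicHodge.fontainePstAdicCompletion v p hv).IsDeRhamFramed (ρ.toLocal v) ∧ (letI := (Literature.NumberTheory.PAdicHodge.fontainePstAdicCompletion v p hv).algebra; ∀ τ : v.adicCompletion F →ₐ[ℚ_[p]] PadicAlgCl p, ∃ a b : ℤ, a < b ∧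 ρ.labelledHodgeTateWeightsAt v (Literature.NumberTheory.PAdicHodge.fontainePstAdicCompletion v p hv).algebra (Literature.NumberTheory.PAdicHodge.fontainePstAdicCompletion v p hv).𝔅 τ.toRingHom = {a, b})) → ¬ (∀ v : IsDedekindDomain.HeightOneSpectrum (NumberField.RingOfIntegers F), ((p : ℕ) : NumberField.RingOfIntegers F) ∈ v.asIdeal → Literature.NumberTheory.GaloisRepresentations.FramedRep.HasInvariantCompleteFlag (ρ.toLocal v)) → (11 ≤ p ∧ (∃ v w : IsDedekindDomain.HeightOneSpectrum (NumberField.RingOfIntegers F), v ≠ w ∧ ((p : ℕ) : NumberField.RingOfIntegers F) ∈ v.asIdeal ∧ ((p : ℕ) : NumberField.RingOfIntegers F) ∈ w.asIdeal) ∧ (∀ (v : IsDedekindDomain.HeightOneSpectrum (NumberField.RingOfIntegers F)) (hv : ((p : ℕ) : NumberField.RingOfIntegers F) ∈ v.asIdeal), (Literature.NumberTheory.PAdicHodge.fontainePstAdicCompletion v p hv).IsCrystallineFramed (ρ.toLocal v)) ∧ Literature.NumberTheory.GaloisRepresentations.FramedGaloisRep.IsResiduallyAbsIrreducible (ρ.restrictField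 (CyclotomicField p F))) → ¬ (∀ (v : IsDedekindDomain.HeightOneSpectrum (NumberField.RingOfIntegers F)) (hv : ((p : ℕ) : NumberField.RingOfIntegers F) ∈ v.asIdeal) (w : IsDedekindDomain.HeightOneSpectrum (NumberField.RingOfIntegers F)) (hw : ((p : ℕ) : NumberField.RingOfIntegers F) ∈ w.asIdeal), letI := (Literature.NumberTheory.PAdicHodge.fontainePstAdicCompletion v p hv).algebra; letI := (Literature.NumberTheory.PAdicHodge.fontainePstAdicCompletion w p hw).algebra; ∀ (τ : v.adicCompletion F →ₐ[ℚ_[p]] PadicAlgCl p) (σ : w.adicCompletion F →ₐ[ℚ_[p]] PadicAlgCl p) (a b a' b' : ℤ), ρ.labelledHodgeTateWeightsAt v (Literature.NumberTheory.PAdicHodge.fontainePstAdicCompletion v p hv).algebra (Literature.NumberTheory.PAdicHodge.fontainePstAdicCompletion v p hv).𝔅 τ.toRingHom = {a, b} → a < b → ρ.labelledHodgeTateWeightsAt w (Literature.NumberTheory.PAdicHodge.fontainePstAdicCompletion w p hw).algebra (Literature.NumberTheory.PAdicHodge.fontainePstAdicCompletion w p hw).𝔅 σ.toRingHom = {a',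 b'} → a' < b' → Even (b - a + (b' - a'))) → (∃ τ : Field.absoluteGaloisGroup ℚ, τ ∉ Set.range (Literature.NumberTheory.GaloisRepresentations.absGaloisRestrict ℚ F) ∧ ∃ χ : Field.absoluteGaloisGroup F →* (Literature.NumberTheory.GaloisRepresentations.padicAlgClResidueField p)ˣ, ∀ σ σ' : Field.absoluteGaloisGroup F, Literature.NumberTheory.GaloisRepresentations.absGaloisRestrict ℚ F σ' = τ * Literature.NumberTheory.GaloisRepresentations.absGaloisRestrict ℚ F σ * τ⁻¹ → (ρ.residualRep σ').val.trace = (χ σ : Literature.NumberTheory.GaloisRepresentations.padicAlgClResidueField p) * (ρ.residualRep σ).val.trace ∧ (ρ.residualRep σ').val.det = (χ σ : Literature.NumberTheory.GaloisRepresentations.padicAlgClResidueField p) ^ 2 * (ρ.residualRep σ).val.det) → False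

/-- **`EmptyWeightCore ↔ RegimeEmpty`.**  `→`: the parallel conclusion contradicts `¬hE`
(`gap_eq_or_of_pair_eq`: both gaps are `± g`, so every gap sum is `0` or `± 2g`); `←`: ex falso.
So the crux is a pure non-existence statement and its only refutation is a witness. [folklore] -/
theorem emptyWeightCore_iff_regimeEmpty : EmptyWeightCore ↔ RegimeEmpty := by
  refine ⟨fun h F _ _ _ hF p _ ρ hirr hunr hHT hLR hG hnE hBC => ?_,
    fun h F _ _ _ hF p _ ρ hirr hunr hHT hLR hG hnE hBC => (h F hF p ρ hirr hunr hHT hLR hG hnE hBC).elim⟩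
  obtain ⟨g, hg⟩ := h F hF p ρ hirr hunr hHT hLR hG hnE hBC
  refine hnE fun v hv w hw τ σ a b a' b' hab hlt hab' hlt' => ?_
  obtain ⟨c, hc⟩ := hg v hv τ
  obtain ⟨c', hc'⟩ := hg w hw σ
  rw [hab] at hc
  rw [hab'] at hc'
  rcases gap_eq_or_of_pair_eq hc hlt with h1 | h1 <;>
    rcases gap_eq_or_of_pair_eq hc' hlt' with h2 | h2
  · exact ⟨g, by omega⟩
  · exact ⟨0, by omega⟩
  · exact ⟨0, by omega⟩
  · exact ⟨-g, by omega⟩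

/-! ## §2 Load-bearing analysis -/

/-- **The de Rham weakening `EmptyWeightCoreDeRham`** — the crux with `IsCrystallineFramed` deleted from
the good-regime hypothesis (de Rham-ness stays in `hHT`).  STATUS: OPEN and believed TRUE (it is the
base-change-residue, odd-gap-sum case of "no irreducible de Rham `ρ : Γ_F → GL₂(ℚ̄_p)` of non-parallel
regular weight over an imaginary quadratic field", a consequence of Fontaine–Mazur + purity / Harder's
vanishing; [CalegariMazur2008] p. 3 and §7.1).  The parity MECHANISM dies here: for de Rham `ρ`,
`det ρ|_{I_v} = ε^{-(a_v+b_v)} · θ_v` with `θ_v` of finite order and `θ̄_v = ω^{j_v}` of arbitrary parity.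
Hence NO theorem `emptyWeightCore_false_without_crystalline` can exist short of a counterexample to
Fontaine–Mazur; this `def` records the exact statement for future seats (it is also what the crux MEANS
for the accepted naive datum of `nonempty_pstWeilDeligneData_bdR`, §3). [cite: CalegariMazur2008, Conjecture 1.3 and §7.1] -/
def EmptyWeightCoreDeRham : Prop :=
  ∀ (F : Type) [Field F] [NumberField F] [Algebra.IsQuadraticExtension ℚ F], NumberField.IsTotallyComplex F → ∀ (p : ℕ) [Fact p.Prime] (ρ : Literature.NumberTheory.GaloisRepresentations.FramedGaloisRep F (PadicAlgCl p) 2), ρ.toGaloisRep.IsIrreducible → (∀ᶠ v : IsDedekindDomain.HeightOneSpectrum (NumberField.RingOfIntegers F) in Filter.cofinite, ρ.IsUnramifiedAt v) → (∀ (v : IsDedekindDomain.HeightOneSpectrum (NumberField.RingOfIntegers F)) (hv : ((p : ℕ) : NumberField.RingOfIntegers F) ∈ v.asIdeal), (Literature.NumberTheory.PAdicHodge.fontainePstAdicCompletion v p hv).IsDeRhamFramed (ρ.toLocal v) ∧ (letI := (Literature.NumberTheory.PAdicHodge.fontainePstAdicCompletion v p hv).algebra; ∀ τ : v.adicCompletion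 F →ₐ[ℚ_[p]] PadicAlgCl p, ∃ a b : ℤ, a < b ∧ ρ.labelledHodgeTateWeightsAt v (Literature.NumberTheory.PAdicHodge.fontainePstAdicCompletion v p hv).algebra (Literature.NumberTheory.PAdicHodge.fontainePstAdicCompletion v p hv).𝔅 τ.toRingHom = {a, b})) → ¬ (∀ v : IsDedekindDomain.HeightOneSpectrum (NumberField.RingOfIntegers F), ((p : ℕ) : NumberField.RingOfIntegers F) ∈ v.asIdeal → Literature.NumberTheory.GaloisRepresentations.FramedRep.HasInvariantCompleteFlag (ρ.toLocal v)) → (11 ≤ p ∧ (∃ v w : IsDedekindDomain.HeightOneSpectrum (NumberField.RingOfIntegers F), v ≠ w ∧ ((p : ℕ) : NumberField.RingOfIntegers F) ∈ v.asIdeal ∧ ((p : ℕ) : NumberField.RingOfIntegers F) ∈ w.asIdeal) ∧ Literature.NumberTheory.GaloisRepresentations.FramedGaloisRep.IsResiduallyAbsIrreducible (ρ.restrictField (CyclotomicField p F))) → ¬ (∀ (v : IsDedekindDomain.HeightOneSpectrum (NumberField.RingOfIntegers F)) (hv : ((p : ℕ) : NumberField.RingOfIntegers F) ∈ v.asIdeal)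 (w : IsDedekindDomain.HeightOneSpectrum (NumberField.RingOfIntegers F)) (hw : ((p : ℕ) : NumberField.RingOfIntegers F) ∈ w.asIdeal), letI := (Literature.NumberTheory.PAdicHodge.fontainePstAdicCompletion v p hv).algebra; letI := (Literature.NumberTheory.PAdicHodge.fontainePstAdicCompletion w p hw).algebra; ∀ (τ : v.adicCompletion F →ₐ[ℚ_[p]] PadicAlgCl p) (σ : w.adicCompletion F →ₐ[ℚ_[p]] PadicAlgCl p) (a b a' b' : ℤ), ρ.labelledHodgeTateWeightsAt v (Literature.NumberTheory.PAdicHodge.fontainePstAdicCompletion v p hv).algebra (Literature.NumberTheory.PAdicHodge.fontainePstAdicCompletion v p hv).𝔅 τ.toRingHom = {a, b} → a < b → ρ.labelledHodgeTateWeightsAt w (Literature.NumberTheory.PAdicHodge.fontainePstAdicCompletion w p hw).algebra (Literature.NumberTheory.PAdicHodge.fontainePstAdicCompletion w p hw).𝔅 σ.toRingHom = {a', b'} → a' < b' → Even (b - a + (b' - a'))) → (∃ τ : Field.absoluteGaloisGroup ℚ, τ ∉ Set.range (Literature.NumberTheory.GaloisRepresentations.absGaloisRestrict ℚ F) ∧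 ∃ χ : Field.absoluteGaloisGroup F →* (Literature.NumberTheory.GaloisRepresentations.padicAlgClResidueField p)ˣ, ∀ σ σ' : Field.absoluteGaloisGroup F, Literature.NumberTheory.GaloisRepresentations.absGaloisRestrict ℚ F σ' = τ * Literature.NumberTheory.GaloisRepresentations.absGaloisRestrict ℚ F σ * τ⁻¹ → (ρ.residualRep σ').val.trace = (χ σ : Literature.NumberTheory.GaloisRepresentations.padicAlgClResidueField p) * (ρ.residualRep σ).val.trace ∧ (ρ.residualRep σ').val.det = (χ σ : Literature.NumberTheory.GaloisRepresentations.padicAlgClResidueField p) ^ 2 * (ρ.residualRep σ).val.det) → False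

/-- The de Rham weakening implies the crux (it drops a hypothesis): recorded so that a future proof of
`EmptyWeightCoreDeRham` (= Fontaine–Mazur in this sector) is seen to close the crux unconditionally,
WITHOUT `FontaineDatumExists`. [folklore] -/
theorem regimeEmpty_of_deRham (h : EmptyWeightCoreDeRham) : RegimeEmpty :=
  fun F _ _ _ hF p _ ρ hirr hunr hHT hLR hG hnE hBC =>
    h F hF p ρ hirr hunr hHT hLR ⟨hG.1, hG.2.1, hG.2.2.2⟩ hnE hBC

/-- **The parity channel carries exactly one bit (odd `p`).**  In the local lemma (stub F) one extracts
from `χ² = ι(ω̄)ⁿ` on `I_K` only `χ(σ₀) = ζ^j`, `ζ^{2j} = ζⁿ` with `ζ` of exact order `p − 1`, i.e.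
`(p − 1) ∣ 2j − n` for SOME `j` — and that is EQUIVALENT to `n` even.  So the determinant transport can
never yield the strategist's strengthening S⁺ (`gaps ≡ ± each other mod (p − 1)`); S⁺ needs the full
Fontaine–Laffaille shape of `ρ̄|_{I}` (clause (F13)), not (F12). [folklore] -/
theorem parity_channel_iff {p : ℕ} (hp : Odd p) (n : ℤ) :
    (∃ j : ℤ, ((p : ℤ) - 1) ∣ 2 * j - n) ↔ Even n := by
  constructor
  · rintro ⟨j, k, hk⟩
    obtain ⟨m, rfl⟩ := hp
    push_cast at hk
    exact ⟨j - m * k, by linarith⟩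
  · rintro ⟨k, rfl⟩
    exact ⟨k, 0, by ring⟩

/-- **`p = 2` kills the channel**: `p − 1 = 1` divides everything, no bit survives (`ω̄` is trivial for
`p = 2`).  Hypothesis `p ≠ 2` of stub F / `11 ≤ p` of the crux is load-bearing for the MECHANISM (the
`p = 2` statement itself is again an open case of Fontaine–Mazur, not known false). [folklore] -/
theorem parity_channel_two (n : ℤ) : ∃ j : ℤ, ((2 : ℕ) : ℤ) - 1 ∣ 2 * j - n :=
  ⟨0, by norm_num⟩

/-- **Inert `p` (`f = 2`) kills the channel.**  For `F_v = ℚ_{p²}` a crystalline `ρ_v` with labelled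
weights `h_τ = a+b`, `h_τ̄ = a'+b'` has `det ρ̄|_I = θ₂^{-(h_τ + p h_τ̄)}`; complex conjugation fixes `v` and
swaps the labels, so base-change type gives `χ̄²|_I = θ₂^{(1-p)(h_τ - h_τ̄)}`, and the characters of
`Γ_{ℚ_{p²}}` restrict to ALL powers of `θ₂` (order `p² − 1`): the condition is `∃ j, (p²−1) ∣ 2j − (p−1)d`,
which ALWAYS holds since `(p − 1)d` is even.  Equivalently `ω̄|_I = θ₂^{p+1} = (θ₂^{(p+1)/2})²` is a
square: the `f = 1` hypothesis (`residueFieldCard K = p`, i.e. SPLIT `p`) of stub F and of the crux is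
load-bearing for the mechanism; the inert sector belongs to `ResidueParallel`. [folklore] -/
theorem parity_channel_inert {p : ℤ} (hp : Odd p) (d : ℤ) :
    ∃ j : ℤ, (p ^ 2 - 1) ∣ 2 * j - (p - 1) * d := by
  obtain ⟨m, rfl⟩ := hp
  exact ⟨m * d, 0, by ring⟩

/-! ## §3 Unrefutability as typed: a twin of the pin with no ramified crystalline representation

Verbatim copy (namespace `Twin`) of the landed negative lemma p167274
`Summit.Langlands.Langlands.Theorems.EmptyWeightCore.Negative.*`; to be replaced by an `import` once merged. -/

namespace Twin

section Special

variable {F : Type} [Field F] [ValuativeRel F] [TopologicalSpace F] [IsNonarchimedeanLocalField F]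
variable (C : Type) [Field C] (n : ℕ)

/-- Scale the `0`-th coordinate of `Fin n → C` by `c`. [folklore] -/
def scale0 (c : C) : (Fin n → C) →ₗ[C] (Fin n → C) where
  toFun v i := if (i : ℕ) = 0 then c * v i else v i
  map_add' v w := by
    funext i
    simp only [Pi.add_apply]
    split_ifs <;> ring
  map_smul' a v := by
    funext i
    simp only [Pi.smul_apply, smul_eq_mul, RingHom.id_apply]
    split_ifs <;> ring

/-- Unfolding lemma for `scale0`. [folklore] -/
@[simp] theorem scale0_apply (c : C) (v : Fin n → C) (i : Fin n) :
    scale0 C n c v i = if (i : ℕ) = 0 then c * v i else v i := rfl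

/-- `scale0 1 = id`. [folklore] -/
theorem scale0_one : scale0 C n 1 = LinearMap.id :=
  LinearMap.ext fun v => funext fun i => by simp

/-- `scale0` is multiplicative. [folklore] -/
theorem scale0_mul (c d : C) : scale0 C n (c * d) = scale0 C n c ∘ₗ scale0 C n d :=
  LinearMap.ext fun v => funext fun i => by
    simp only [scale0_apply, LinearMap.coe_comp, Function.comp_apply]
    split_ifs <;> ring

/-- The "monodromy" `N`: coordinate `1` is sent to coordinate `0`, everything else to `0`
(`N = E₀₁`; the zero map when `n ≤ 1`). [folklore] -/
def spN : (Fin n → C) →ₗ[C] (Fin n → C) where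
  toFun v i := if (i : ℕ) = 0 then (if h : 1 < n then v ⟨1, h⟩ else 0) else 0
  map_add' v w := by
    funext i
    simp only [Pi.add_apply]
    split_ifs <;> simp
  map_smul' a v := by
    funext i
    simp only [Pi.smul_apply, smul_eq_mul, RingHom.id_apply]
    split_ifs <;> simp

/-- Unfolding lemma for `spN`. [folklore] -/
@[simp] theorem spN_apply (v : Fin n → C) (i : Fin n) :
    spN C n v i = if (i : ℕ) = 0 then (if h : 1 < n then v ⟨1, h⟩ else 0) else 0 := rfl

/-- `N² = 0`. [folklore] -/
theorem spN_comp_spN : spN C n ∘ₗ spN C n = 0 :=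
  LinearMap.ext fun v => funext fun i => by
    simp [spN_apply]

/-- `N ≠ 0` in rank `≥ 2` (it sends `e₁` to `e₀`). [folklore] -/
theorem spN_ne_zero (hn : 2 ≤ n) : spN C n ≠ 0 := by
  intro h
  have h1 : 1 < n := by omega
  have h0 : 0 < n := by omega
  have := congrArg (fun f : (Fin n → C) →ₗ[C] (Fin n → C) =>
    f (fun j => if (j : ℕ) = 1 then (1 : C) else 0) ⟨0, h0⟩) h
  simp [spN_apply, h1] at this

variable [CharZero C]

variable (F) in
/-- The Steinberg-type ("special") representation of `W_F` on `Fin n → C`: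
`w ↦ diag(q^{deg w}, 1, …, 1)`. [cite: TateCorvallis1979, (4.1.4)] -/
def spRep : Representation C (WeilGroup F) (Fin n → C) where
  toFun w := scale0 C n ((residueFieldCard F : C) ^ (WeilGroup.deg w))
  map_one' := by
    rw [WeilGroup.deg_one IsFrobPow.mul_holds IsFrobPow.unique_holds, zpow_zero, scale0_one]
    rfl
  map_mul' w w' := by
    rw [WeilGroup.deg_mul IsFrobPow.mul_holds IsFrobPow.unique_holds,
      zpow_add₀ (by exact_mod_cast residueFieldCard_ne_zero F), scale0_mul]
    rfl

/-- Unfolding lemma for `spRep`. [cite: TateCorvallis1979, (4.1.4)] -/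
@[simp] theorem spRep_apply (w : WeilGroup F) :
    spRep F C n w = scale0 C n ((residueFieldCard F : C) ^ (WeilGroup.deg w)) := rfl

/-- The Steinberg-type representation of `W_F` is unramified (`deg = 0` on `I_F`).
[cite: TateCorvallis1979, (4.1.4)] -/
theorem spRep_isUnramified : WeilGroup.IsUnramifiedRep (spRep F C n) := by
  intro u hu
  rw [spRep_apply, (WeilGroup.deg_eq_zero_iff_mem_inertia IsFrobPow.mul_holds
    IsFrobPow.unique_holds).2 hu, zpow_zero, scale0_one]
  rfl

variable (F) in
/-- The Steinberg-type Weil–Deligne representation `(diag(q^{deg}, 1, …, 1), N = E₀₁)`: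
UNRAMIFIED on `W_F` but with `N ≠ 0` as soon as `n ≥ 2`. [cite: TateCorvallis1979, (4.1.4)] -/
def spWD : WeilDeligneRep F C (Fin n → C) where
  ρ := spRep F C n
  isContinuous := (spRep_isUnramified C n).isContinuousRep
  N := spN C n
  isNilpotent_N := ⟨2, by rw [pow_two, Module.End.mul_eq_comp, spN_comp_spN]⟩
  conj_N w := LinearMap.ext fun v => funext fun i => by
    simp only [spRep_apply, LinearMap.coe_comp, Function.comp_apply, scale0_apply, spN_apply,
      LinearMap.smul_apply, Pi.smul_apply, smul_eq_mul, one_ne_zero, ↓reduceIte]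
    split_ifs <;> simp

/-- The monodromy of `spWD` is `spN`. [folklore] -/
@[simp] theorem spWD_N : (spWD F C n).N = spN C n := rfl

/-- A Weil–Deligne representation with `N = 0` is not isomorphic to the Steinberg-type one in rank
`≥ 2`. [folklore] -/
theorem not_isEquivalent_spWD_of_N_eq_zero (hn : 2 ≤ n) {V : Type} [AddCommGroup V] [Module C V]
    {r : WeilDeligneRep F C V} (hN : r.N = 0) : ¬ r.IsEquivalent (spWD F C n) := by
  rintro ⟨e⟩
  apply spN_ne_zero C n hn
  have h := e.symm.comm_N
  rw [hN, LinearMap.zero_comp, spWD_N] at h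
  refine LinearMap.ext fun v => ?_
  have hv := congrArg (fun f => f v) h
  simp only [LinearMap.coe_comp, Function.comp_apply, LinearMap.zero_apply] at hv
  have hinj : Function.Injective e.symm.toLinearEquiv := e.symm.toLinearEquiv.injective
  rw [LinearMap.zero_apply]
  apply hinj
  rw [map_zero]
  exact hv

end Special

/-! ## The datum -/

variable {F : Type} [Field F] [ValuativeRel F] [TopologicalSpace F] [IsNonarchimedeanLocalField F]
  {p : ℕ} [Fact p.Prime]
variable [CharZero F] [Fact (¬ IsUnit (p : integerC F))]
  [IsAdicComplete (Ideal.span {(p : integerC F)}) (integerC F)] [Algebra ℚ_[p] F]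

set_option maxSynthPendingDepth 3 in
/-- **A pin-candidate datum on `B_dR(F)` with no ramified crystalline representation of rank `≥ 2`.**
There is a `p`-adic Hodge datum `𝔇` with the GIVEN `ℚ_p`-structure and period ring Fontaine's
`B_dR(F)` (`bdRPeriodRingData hp`) — i.e. in the subtype over which Hilbert's `ε` of the pin
`fontainePst` ranges — whose five structure axioms hold and for which, in every rank `n ≥ 2`,
`𝔇`-crystalline representations are unramified.  Witness: unramified `ρ ↦ (ρ|_{W_F}, 0)` (as in
`nonempty_pstWeilDeligneData_bdR`), RAMIFIED `ρ ↦` the Steinberg-type `(diag(q^{deg},1,…,1), E₀₁)`,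
which has `N ≠ 0`. [folklore] -/
theorem exists_bdRDatum_isCrystallineFramed_imp_isLocallyUnramified (hp : valuation F p < 1) :
    ∃ 𝔇 : PstWeilDeligneData F p, 𝔇.algebra = ‹Algebra ℚ_[p] F› ∧
      𝔇.𝔅 = (letI := 𝔇.algebra; bdRPeriodRingData (F := F) (p := p) hp) ∧
      ∀ {n : ℕ}, 2 ≤ n → ∀ ρ : FramedRep (absoluteGaloisGroup F) (PadicAlgCl p) n,
        𝔇.IsCrystallineFramed ρ → ρ.IsLocallyUnramified := by
  -- the Weil–Deligne relation: naive on unramified `ρ`, Steinberg-type on ramified `ρ`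
  let R : ∀ {n : ℕ}, FramedRep (absoluteGaloisGroup F) (PadicAlgCl p) n →
      WeilDeligneRep F (PadicAlgCl p) (Fin n → PadicAlgCl p) → Prop := fun {n} ρ r =>
    (ρ.IsLocallyUnramified ∧ r.N = 0 ∧ Nonempty (Representation.Equiv r.ρ (ρ.weilRestrict F))) ∨
      (¬ ρ.IsLocallyUnramified ∧ r.IsEquivalent (spWD F (PadicAlgCl p) n))
  let 𝔇 : PstWeilDeligneData F p :=
    { algebra := ‹Algebra ℚ_[p] F›
      𝔅 := bdRPeriodRingData (F := F) (p := p) hp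
      IsWeilDeligneOf := R
      exists_of_isDeRham := by
        intro n ρ _
        by_cases hu : ρ.IsLocallyUnramified
        · exact ⟨WeilDeligneRep.ofRep (ρ.weilRestrict F) hu.isUnramifiedRep_weilRestrict.isContinuousRep,
            Or.inl ⟨hu, rfl, ⟨Representation.Equiv.refl _⟩⟩⟩
        · exact ⟨spWD F (PadicAlgCl p) n, Or.inr ⟨hu, WeilDeligneRep.IsEquivalent.refl _⟩⟩
      isEquivalent := by
        intro n ρ r r' h h'
        rcases h with ⟨hu, hN, ⟨e⟩⟩ | ⟨hu, he⟩
        · rcases h' with ⟨_, hN', ⟨e'⟩⟩ | ⟨hu', _⟩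
          · exact ⟨{ toRepEquiv := e.trans e'.symm
                     comm_N := by rw [hN, hN', LinearMap.comp_zero, LinearMap.zero_comp] }⟩
          · exact absurd hu hu'
        · rcases h' with ⟨hu', _, _⟩ | ⟨_, he'⟩
          · exact absurd hu' hu
          · exact he.trans he'.symm
      conj := by
        intro n g ρ r h
        rcases h with ⟨hu, hN, ⟨e⟩⟩ | ⟨hu, he⟩
        · exact Or.inl ⟨(FramedRep.isLocallyUnramified_conj_iff g ρ).2 hu, hN,
            ⟨e.trans (FramedRep.weilRestrictConjEquiv g ρ)⟩⟩
        · exact Or.inr ⟨fun h => hu ((FramedRep.isLocallyUnramified_conj_iff g ρ).1 h), he⟩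
      isDeRhamWith_of_isLocallyUnramified := fun ρ h =>
        ρ.isDeRhamWith_bdR_of_isLocallyUnramified hp h
      wd_of_isLocallyUnramified := by
        intro n ρ r hρ h
        rcases h with ⟨_, hN, ⟨e⟩⟩ | ⟨hu, _⟩
        · refine ⟨hN, fun u hu => LinearMap.ext fun v => ?_⟩
          have h1 := Representation.IntertwiningMap.isIntertwining _ _ e.toIntertwiningMap u v
          rw [hρ.isUnramifiedRep_weilRestrict u hu] at h1
          exact e.injective h1
        · exact absurd hρ hu }
  refine ⟨𝔇, rfl, rfl, fun {n} hn ρ hρ => ?_⟩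
  obtain ⟨_, r, hr, hN, _⟩ := hρ
  rcases hr with ⟨hu, _, _⟩ | ⟨_, he⟩
  · exact hu
  · exact absurd he (not_isEquivalent_spWD_of_N_eq_zero (PadicAlgCl p) n hn hN)


/-! ## Twins of THE pinned datum -/

section Pin

omit [Fact (¬ IsUnit (p : integerC F))] [IsAdicComplete (Ideal.span {(p : integerC F)}) (integerC F)]
  [Algebra ℚ_[p] F] in
/-- **A twin of THE pinned datum `fontainePst F p hp` with no ramified crystalline representation of
rank `≥ 2`.**  There is a datum with the SAME `ℚ_p`-structure and the SAME period ring as the pin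
(the two invariants of `fontainePst` the tree knows unconditionally:
`fontainePst_algebra_eq_padicAlgebra`, `fontainePst_𝔅_eq_bdRPeriodRingData`; `HEq` because the type
of `𝔅` mentions the `algebra` field) for which
`IsCrystallineFramed ρ → ρ.IsLocallyUnramified` in every rank `n ≥ 2`.  Hence NO argument that is
uniform over Hilbert's `ε`-range can certify `(fontainePst F p hp).IsCrystallineFramed ρ` for a
ramified `ρ` of rank `≥ 2` — the crystallinity hypothesis of crux `EmptyWeightCore` at `v ∣ p` is
uncertifiable without `FontaineDatumExists` (and a refutation of the crux would need exactly that).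
[folklore] -/
theorem exists_twin_fontainePst_isCrystallineFramed_imp_isLocallyUnramified
    (hp : valuation F p < 1) :
    ∃ 𝔇 : PstWeilDeligneData F p, 𝔇.algebra = (fontainePst F p hp).algebra ∧
      HEq 𝔇.𝔅 (fontainePst F p hp).𝔅 ∧
      ∀ {n : ℕ}, 2 ≤ n → ∀ ρ : FramedRep (absoluteGaloisGroup F) (PadicAlgCl p) n,
        𝔇.IsCrystallineFramed ρ → ρ.IsLocallyUnramified := by
  letI := LocalField.padicAlgebra F p hp
  haveI : Fact (¬ IsUnit ((p : ℕ) : integerC F)) := ⟨not_isUnit_natCast_integerC hp⟩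
  haveI : IsAdicComplete (Ideal.span {((p : ℕ) : integerC F)}) (integerC F) :=
    isAdicComplete_integerC_natCast hp
  obtain ⟨𝔇, halg, h𝔅, h⟩ := exists_bdRDatum_isCrystallineFramed_imp_isLocallyUnramified (F := F) hp
  have halg' : 𝔇.algebra = (fontainePst F p hp).algebra :=
    halg.trans (fontainePst_algebra_eq_padicAlgebra hp).symm
  refine ⟨𝔇, halg', ?_, h⟩
  rw [h𝔅, fontainePst_𝔅_eq_bdRPeriodRingData hp]
  exact congr_arg_heq
    (fun a : Algebra ℚ_[p] F => (letI := a; bdRPeriodRingData (F := F) (p := p) hp)) halg'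

variable {K : Type} [Field K] [NumberField K]

open IsDedekindDomain NumberField in
/-- **The same at a place `v ∣ p` of a number field, for the summit's datum
`fontainePstAdicCompletion v p hv`** — the term in the hypotheses `IsCrystallineFramed (ρ.toLocal v)`
of crux `EmptyWeightCore` (`NonParallelVoid`, stmt-Langlands-17008): a twin datum with the pin's
`ℚ_p`-structure and period ring declares no ramified rank-`≥ 2` representation of `Γ_{K_v}`
crystalline. [folklore] -/
theorem exists_twin_fontainePstAdicCompletion_isCrystallineFramed_imp_isLocallyUnramified
    (v : HeightOneSpectrum (𝓞 K)) (p : ℕ) [Fact p.Prime] (hv : ((p : ℕ) : 𝓞 K) ∈ v.asIdeal) :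
    ∃ 𝔇 : PstWeilDeligneData (v.adicCompletion K) p,
      𝔇.algebra = (fontainePstAdicCompletion v p hv).algebra ∧
      HEq 𝔇.𝔅 (fontainePstAdicCompletion v p hv).𝔅 ∧
      ∀ {n : ℕ}, 2 ≤ n →
        ∀ ρ : FramedRep (absoluteGaloisGroup (v.adicCompletion K)) (PadicAlgCl p) n,
          𝔇.IsCrystallineFramed ρ → ρ.IsLocallyUnramified := by
  haveI := LocalField.charZero_adicCompletion v
  exact exists_twin_fontainePst_isCrystallineFramed_imp_isLocallyUnramified
    (LocalField.valuation_adicCompletion_natCast_lt_one v p hv)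

end Pin

end Twin

/-- **Corollary for the crux's own term.**  At every place `v ∣ p` of every number field there is a datum
with the SAME `ℚ_p`-structure and the SAME (`HEq`) period ring as `fontainePstAdicCompletion v p hv` for
which a crystalline `ρ_v` of rank 2 is unramified — while hypothesis `hHT` of the crux (two DISTINCT
labelled weights) is, for Fontaine's `B_dR`, incompatible with `ρ_v` unramified (unramified ⇒ all weights
`0`, `fontainePstAdicCompletion_unramifiedWeightsZero`).  So no `ρ` can be PROVED to lie in the regime by
an argument that does not distinguish the pin from its twin: `¬EmptyWeightCore` is unprovable in the
current tree (and would stay so under `FontaineDatumExists`, whose clauses never force a given ramified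
rank-2 `ρ_v` to be crystalline). [folklore] -/
theorem crux_crystalline_hyp_has_voiding_twin {K : Type} [Field K] [NumberField K]
    (v : HeightOneSpectrum (𝓞 K)) (p : ℕ) [Fact p.Prime] (hv : ((p : ℕ) : 𝓞 K) ∈ v.asIdeal) :
    ∃ 𝔇 : PstWeilDeligneData (v.adicCompletion K) p,
      𝔇.algebra = (fontainePstAdicCompletion v p hv).algebra ∧
      HEq 𝔇.𝔅 (fontainePstAdicCompletion v p hv).𝔅 ∧
      ∀ ρ : FramedRep (absoluteGaloisGroup (v.adicCompletion K)) (PadicAlgCl p) 2,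
        𝔇.IsCrystallineFramed ρ → ρ.IsLocallyUnramified := by
  obtain ⟨𝔇, h1, h2, h3⟩ :=
    Twin.exists_twin_fontainePstAdicCompletion_isCrystallineFramed_imp_isLocallyUnramified v p hv
  exact ⟨𝔇, h1, h2, fun ρ hρ => h3 le_rfl ρ hρ⟩

/-! ## §4–§5 (prose in the module docstring): stub pre-triage of `local_clause_cut`, and what would kill.

-- Targets: none served this cycle (payload `targets = []`); the seven stubs read TRUE as typed. -/

end Summit.Langlands.Langlands.Cruxes.EmptyWeightCore.Disproof

end
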